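import Summits.CriticalPhenomena.PercolationContinuityZ3.Theorems.PercNearOneGluingNoHeavyLowerTailSahiTangentVertexFiveFKG
import Summits.CriticalPhenomena.PercolationContinuityZ3.Theorems.PercNearOneGluingNoHeavyLowerTailSahiTangentMinimalOrders

/-!
# `NoHeavyLowerTail` (crux stmt-CriticalPhenomena-4575), Sahi programme: **`s ↦ E_n^{B_s⊗ν}(ε·1_{U_1},…,ε·1_{U_n})/s` IS NON-INCREASING ON `(0,1]`**
# for arbitrary up-sets under every FKG weight, `n ≤ 5` — the chord form of Conjecture T_n at the all-top-only vertex improves itself to the monotone form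

Support file (Sahi cell, seat `prim-sahi-p1`, generation 50; `--supports stmt-CriticalPhenomena-4575`).  Pure proofs, NO definitions, no `sorry`,
standard axioms.

OBSERVATION.  The class "arbitrary up-sets of a finite distributive lattice under an FKG weight" is closed under adjoining the coin: `B_s ⊗ ν` is FKG on
`Bool × α` (`SahiTangent.isFKGMeasure_coin`) and `{true} × U` is an up-set there whose indicator is the top-only slot of `U`.  Applying the all-top-only
vertex inequality (`sahiE_three/four/five_coin_topOnly_ge`, files `…VertexFourFKG`, `…VertexFiveFKG`) to `ν' = B_s ⊗ ν` with a second coin of bias `r`,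
and identifying the two-coin family with the one-coin family of bias `rs` (`sahiE_coin_coin_topOnly`, by `sahiE_congr_of_moments`), gives
`r · E_n^{B_s⊗ν}(ε·1_{U_l}) ≤ E_n^{B_{rs}⊗ν}(ε·1_{U_l})` for all `r, s ∈ [0,1]` (`sahiE_three/four/five_coin_topOnly_ratio`): MONOTONICITY of
`s ↦ E_n^{B_s⊗ν}(ε·1_U)/s`.  Percolation reading: for increasing events `A_l` not depending on an edge `e`, `p_e ↦ E_n(A_1 ∩ {e open},…,A_n ∩ {e open})/p_e`
is non-increasing (`n ≤ 5`).
Nothing conjectural is asserted. [this work]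
-/

namespace Summit.CriticalPhenomena.PercolationContinuityZ3.Theorems.SahiTangent

open Finset Function Literature.Combinatorics.Sahi2008
open Literature.Probability.LatticeModels (mass)
open scoped BigOperators

noncomputable section

variable {α : Type*} [DistribLattice α] [Fintype α] [DecidableEq α]

omit [DistribLattice α] [Fintype α] in
/-- The top-only slot of `U` is the indicator of `{true} × U`. [this work] -/
theorem topOnly_eq_setInd_prod (U : Finset α) :
    (fun z : Bool × α => if z.1 then setInd U z.2 else 0) = setInd (({true} : Finset Bool) ×ˢ U) := by
  funext z; rcases z with ⟨b, x⟩
  cases b <;> simp [setInd_apply]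

omit [DistribLattice α] [Fintype α] [DecidableEq α] in
/-- `{true} × U` is an up-set of `Bool × α` when `U` is an up-set. [this work] -/
theorem isUpperSet_true_prod [Preorder α] {U : Finset α} (hU : IsUpperSet (U : Set α)) :
    IsUpperSet (((({true} : Finset Bool) ×ˢ U : Finset (Bool × α)) : Set (Bool × α))) := by
  rintro ⟨a1, a2⟩ ⟨b1, b2⟩ hab ha
  rw [Finset.mem_coe, Finset.mem_product, Finset.mem_singleton] at ha ⊢
  obtain ⟨ha1, ha2⟩ := ha
  have h1 : a1 ≤ b1 := hab.1
  subst ha1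
  cases b1
  · exact absurd h1 (by decide)
  · exact ⟨rfl, hU hab.2 ha2⟩

omit [DistribLattice α] [Fintype α] [DecidableEq α] in
/-- Mass of `{true} × A` under `B_s ⊗ ν`. [this work] -/
theorem mass_coin_true_prod (ν : α → ℝ) (s : ℝ) (A : Finset α) :
    mass (fun z : Bool × α => if z.1 then s * ν z.2 else (1 - s) * ν z.2) (({true} : Finset Bool) ×ˢ A) = s * mass ν A := by
  unfold mass
  rw [Finset.sum_product, Finset.sum_singleton, Finset.mul_sum]
  simp

omit [DistribLattice α] [Fintype α] in
/-- Intersections of the lifted sets: `⋂_S ({true} × U_l) = {true} × ⋂_S U_l` (nonempty `S`, as an `inf` over `Finset.cons`). [this work] -/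
theorem true_prod_inter (A B : Finset α) :
    (({true} : Finset Bool) ×ˢ A) ∩ (({true} : Finset Bool) ×ˢ B) = ({true} : Finset Bool) ×ˢ (A ∩ B) := by
  rw [Finset.product_inter_product, Finset.inter_self]

omit [DistribLattice α] [Fintype α] in
/-- Products of top-only slots over a nonempty finset of slots (generic base type). [this work] -/
theorem prod_topOnly_eq {β : Type*} [DecidableEq β] {n : ℕ} (V : Fin n → Finset β) {S : Finset (Fin n)} (hS : S.Nonempty) :
    ∃ W : Finset β, (∏ l ∈ S, fun z : Bool × β => if z.1 then setInd (V l) z.2 else 0) = (fun z : Bool × β => if z.1 then setInd W z.2 else 0)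
      ∧ ∀ (γ : Type*) [DecidableEq γ] (φ : Finset β → Finset γ), (∀ A B, φ (A ∩ B) = φ A ∩ φ B) →
        (∏ l ∈ S, fun z : Bool × γ => if z.1 then setInd (φ (V l)) z.2 else 0) = (fun z : Bool × γ => if z.1 then setInd (φ W) z.2 else 0) := by
  induction hS using Finset.Nonempty.cons_induction with
  | singleton a => exact ⟨V a, by simp, fun γ _ φ _ => by simp⟩
  | cons a s ha hs ih =>
    obtain ⟨W, hW, hφ⟩ := ih
    refine ⟨V a ∩ W, ?_, fun γ _ φ hφi => ?_⟩
    · rw [Finset.prod_cons, hW, topOnly_mul]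
    · rw [Finset.prod_cons, hφ γ φ hφi, topOnly_mul, hφi]

omit [DistribLattice α] in
/-- **Transport**: the all-top-only family over the two-coin weight `B_r ⊗ (B_s ⊗ ν)` on `Bool × (Bool × α)` (lifted sets `{true} × U_l`) has the same
`E_n` as the all-top-only family over `B_{rs} ⊗ ν`. [this work] -/
theorem sahiE_coin_coin_topOnly (ν : α → ℝ) (r s : ℝ) {n : ℕ} (U : Fin n → Finset α) :
    sahiE (fun z' : Bool × (Bool × α) => if z'.1 then r * (if z'.2.1 then s * ν z'.2.2 else (1 - s) * ν z'.2.2)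
        else (1 - r) * (if z'.2.1 then s * ν z'.2.2 else (1 - s) * ν z'.2.2)) n
        (fun l (z' : Bool × (Bool × α)) => if z'.1 then setInd (({true} : Finset Bool) ×ˢ U l) z'.2 else 0)
      = sahiE (fun z : Bool × α => if z.1 then (r * s) * ν z.2 else (1 - r * s) * ν z.2) n
        (fun l (z : Bool × α) => if z.1 then setInd (U l) z.2 else 0) := by
  refine sahiE_congr_of_moments _ _ n _ _ fun S hS => ?_
  obtain ⟨W, hW, hφ⟩ := prod_topOnly_eq U hS
  have hlift := hφ (Bool × α) (fun A => ({true} : Finset Bool) ×ˢ A) (fun A B => (true_prod_inter A B).symm)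
  rw [hlift, hW]
  have e1 := ex_coin_topOnly (fun z : Bool × α => if z.1 then s * ν z.2 else (1 - s) * ν z.2) r (({true} : Finset Bool) ×ˢ W)
  have e2 := ex_coin_topOnly ν (r * s) W
  rw [e1, e2, mass_coin_true_prod]
  ring

/-- **Order 3**: `r·E_3^{B_s⊗ν}(ε·1_U) ≤ E_3^{B_{rs}⊗ν}(ε·1_U)` (arbitrary up-sets, any FKG weight): `s ↦ E_3^{B_s⊗ν}(ε·1_U)/s` is non-increasing. [this work] -/
theorem sahiE_three_coin_topOnly_ratio {ν : α → ℝ} (hν : IsFKGMeasure ν) {r s : ℝ} (hr0 : 0 ≤ r) (hr1 : r ≤ 1) (hs0 : 0 ≤ s) (hs1 : s ≤ 1)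
    (U : Fin 3 → Finset α) (hU : ∀ l, IsUpperSet (U l : Set α)) :
    r * sahiE (fun z : Bool × α => if z.1 then s * ν z.2 else (1 - s) * ν z.2) 3 (fun l (z : Bool × α) => if z.1 then setInd (U l) z.2 else 0) ≤
      sahiE (fun z : Bool × α => if z.1 then (r * s) * ν z.2 else (1 - r * s) * ν z.2) 3 (fun l (z : Bool × α) => if z.1 then setInd (U l) z.2 else 0) := by
  have h := sahiE_three_coin_topOnly_ge (isFKGMeasure_coin hν hs0 hs1) hr0 hr1 (fun l => ({true} : Finset Bool) ×ˢ U l)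
    (fun l => isUpperSet_true_prod (hU l))
  rw [sahiE_coin_coin_topOnly] at h
  have e : (fun l => setInd (({true} : Finset Bool) ×ˢ U l)) = fun l (z : Bool × α) => if z.1 then setInd (U l) z.2 else 0 := by
    funext l; rw [topOnly_eq_setInd_prod]
  rw [e] at h
  exact h

/-- **Order 4**: `r·E_4^{B_s⊗ν}(ε·1_U) ≤ E_4^{B_{rs}⊗ν}(ε·1_U)` (arbitrary up-sets, any FKG weight): `s ↦ E_4^{B_s⊗ν}(ε·1_U)/s` is non-increasing. [this work] -/
theorem sahiE_four_coin_topOnly_ratio {ν : α → ℝ} (hν : IsFKGMeasure ν) {r s : ℝ} (hr0 : 0 ≤ r) (hr1 : r ≤ 1) (hs0 : 0 ≤ s) (hs1 : s ≤ 1)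
    (U : Fin 4 → Finset α) (hU : ∀ l, IsUpperSet (U l : Set α)) :
    r * sahiE (fun z : Bool × α => if z.1 then s * ν z.2 else (1 - s) * ν z.2) 4 (fun l (z : Bool × α) => if z.1 then setInd (U l) z.2 else 0) ≤
      sahiE (fun z : Bool × α => if z.1 then (r * s) * ν z.2 else (1 - r * s) * ν z.2) 4 (fun l (z : Bool × α) => if z.1 then setInd (U l) z.2 else 0) := by
  have h := sahiE_four_coin_topOnly_ge (isFKGMeasure_coin hν hs0 hs1) hr0 hr1 (fun l => ({true} : Finset Bool) ×ˢ U l)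
    (fun l => isUpperSet_true_prod (hU l))
  rw [sahiE_coin_coin_topOnly] at h
  have e : (fun l => setInd (({true} : Finset Bool) ×ˢ U l)) = fun l (z : Bool × α) => if z.1 then setInd (U l) z.2 else 0 := by
    funext l; rw [topOnly_eq_setInd_prod]
  rw [e] at h
  exact h

/-- **Order 5**: `r·E_5^{B_s⊗ν}(ε·1_U) ≤ E_5^{B_{rs}⊗ν}(ε·1_U)` (arbitrary up-sets, any FKG weight): `s ↦ E_5^{B_s⊗ν}(ε·1_U)/s` is non-increasing. [this work] -/
theorem sahiE_five_coin_topOnly_ratio {ν : α → ℝ} (hν : IsFKGMeasure ν) {r s : ℝ} (hr0 : 0 ≤ r) (hr1 : r ≤ 1) (hs0 : 0 ≤ s) (hs1 : s ≤ 1)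
    (U : Fin 5 → Finset α) (hU : ∀ l, IsUpperSet (U l : Set α)) :
    r * sahiE (fun z : Bool × α => if z.1 then s * ν z.2 else (1 - s) * ν z.2) 5 (fun l (z : Bool × α) => if z.1 then setInd (U l) z.2 else 0) ≤
      sahiE (fun z : Bool × α => if z.1 then (r * s) * ν z.2 else (1 - r * s) * ν z.2) 5 (fun l (z : Bool × α) => if z.1 then setInd (U l) z.2 else 0) := by
  have h := sahiE_five_coin_topOnly_ge (isFKGMeasure_coin hν hs0 hs1) hr0 hr1 (fun l => ({true} : Finset Bool) ×ˢ U l)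
    (fun l => isUpperSet_true_prod (hU l))
  rw [sahiE_coin_coin_topOnly] at h
  have e : (fun l => setInd (({true} : Finset Bool) ×ˢ U l)) = fun l (z : Bool × α) => if z.1 then setInd (U l) z.2 else 0 := by
    funext l; rw [topOnly_eq_setInd_prod]
  rw [e] at h
  exact h

end

end Summit.CriticalPhenomena.PercolationContinuityZ3.Theorems.SahiTangent
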